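import Mathlib
import HarnessLib
import Summits.ValiantsHypothesis.ValiantsHypothesis.Theorems.LacunarySymmetroidMatrixDescartesInertiaJumpPencil

/-!
# Route «KPlusLogSqLaw», `WeakLifting` (stmt-ValiantsHypothesis-19561) — inertia kit companion: SPLITTING A KERNEL BY THE SIGN OF A FORM —
# kernel families `n⁺` (form positive on combinations) and `n⁰` (form non-positive on combinations, linearly independent) with
# `card n⁺ + card n⁰ = dim ker`

HONEST FRAMING.  Helper file (hand leafhand-val-kpluslogsqlaw-1 g14, 2026-08-31; `--supports stmt-ValiantsHypothesis-19561 --as helper`,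
zero crux / stub credit).  General linear algebra for ANY real square matrix `A` and ANY real symmetric `G` (no pencil, no format):
`Inertia.exists_kernel_split` — there are kernel families `n⁺ : β → ker A`, `n⁰ : γ → ker A` (finite index types) with `G` POSITIVE on
the non-trivial combinations of `n⁺`, NON-POSITIVE on all combinations of `n⁰`, `n⁰` linearly independent, and `card β + card γ = corank A`
(a kernel basis `P` — `Inertia.exists_kernel_basis` —, the symmetric matrix `K = [Pᵢᵀ G Pⱼ]`, and the images of its positive /
non-positive eigenvector families `Inertia.pos_eigenFamily` / `nonpos_eigenFamily` under `y ↦ Σ yᵢPᵢ`).  WHY: step (U2) of the located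
two-class mixed-gauge law `ζ ≤ n + 2m` at every ratio (memo evidence-g14-mixed-gauge-all-ratios.md on the item): at each positive root of the
block pencil the positive family feeds the one-sided jump laws / refined window (`Inertia.negIndex_refined_window`, p833516) and the
non-positive family feeds the family downward law (`MixedGauge.family_card_le_blocks`, p833439).  Nothing here is about `WeakLifting` /
`TropicalB` in their windows, the registered stubs, the doors, `MatrixDescartes` (18050) or VP ≠ VNP.  No `def`; axioms standard. [folklore]
-/

set_option linter.dupNamespace false
set_option autoImplicit false

namespace Summit.ValiantsHypothesis.ValiantsHypothesis.Theorems.LacunarySymmetroidMatrixDescartes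

open Matrix Finset
open scoped BigOperators

namespace Inertia

variable {ι : Type} [Fintype ι]

omit [Fintype ι] in
/-- the combination map of a family is additive in the obvious bilinear way: `Σᵢ (Σ_l c_l b_l i) • P i = Σ_l c_l • Σᵢ b_l i • P i`.
[folklore] -/
theorem sum_sum_smul_comm {k : ℕ} {α : Type} [Fintype α] (P : Fin k → ι → ℝ) (b : α → Fin k → ℝ) (c : α → ℝ) :
    ∑ i, (∑ l, c l • b l) i • P i = ∑ l, c l • ∑ i, b l i • P i := by
  simp_rw [Finset.smul_sum, Finset.sum_apply, Pi.smul_apply, smul_eq_mul, Finset.sum_smul, mul_smul]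
  exact Finset.sum_comm

/-- the form of a combination of a family `P` is the form of the coefficient vector for the matrix `K = [Pᵢᵀ G Pⱼ]`. [folklore] -/
theorem form_comb_eq {k : ℕ} (G : Matrix ι ι ℝ) (P : Fin k → ι → ℝ) (y : Fin k → ℝ) :
    (∑ i, y i • P i) ⬝ᵥ (G *ᵥ ∑ j, y j • P j)
      = y ⬝ᵥ ((Matrix.of fun i j => P i ⬝ᵥ (G *ᵥ P j)) *ᵥ y) := by
  rw [Matrix.mulVec_sum, sum_dotProduct]
  rw [dotProduct]
  refine Finset.sum_congr rfl fun i _ => ?_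
  rw [dotProduct_sum, Matrix.mulVec, dotProduct, Finset.mul_sum]
  refine Finset.sum_congr rfl fun j _ => ?_
  rw [Matrix.mulVec_smul, smul_dotProduct, dotProduct_smul, Matrix.of_apply, smul_eq_mul, smul_eq_mul]
  ring

/-- **SPLITTING A KERNEL BY THE SIGN OF A SYMMETRIC FORM.**  `A` any real square matrix, `G` real symmetric.  There are finite kernel
families `n⁺ : β → ℝ^ι`, `n⁰ : γ → ℝ^ι` of `A` with: `G` positive on every non-trivial combination of `n⁺`; `G` non-positive on every
combination of `n⁰`; `n⁰` linearly independent; `card β + card γ = card ι − rank A`. [folklore] -/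
theorem exists_kernel_split (A G : Matrix ι ι ℝ) (hG : G.IsSymm) :
    ∃ (p q : ℕ) (np : Fin p → ι → ℝ) (nn : Fin q → ι → ℝ),
      (∀ j, A *ᵥ np j = 0) ∧ (∀ j, A *ᵥ nn j = 0) ∧
      (∀ c : Fin p → ℝ, c ≠ 0 → 0 < (∑ j, c j • np j) ⬝ᵥ (G *ᵥ ∑ j, c j • np j)) ∧
      (∀ c : Fin q → ℝ, (∑ j, c j • nn j) ⬝ᵥ (G *ᵥ ∑ j, c j • nn j) ≤ 0) ∧
      LinearIndependent ℝ nn ∧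
      p + q = Fintype.card ι - A.rank := by
  classical
  obtain ⟨k, P, hli, hker, hrank⟩ := exists_kernel_basis A
  -- the compressed form
  set K : Matrix (Fin k) (Fin k) ℝ := Matrix.of fun i j => P i ⬝ᵥ (G *ᵥ P j) with hKdef
  have hKsymm : K.IsSymm := by
    ext i j
    simp only [hKdef, Matrix.transpose_apply, Matrix.of_apply]
    -- P j ⬝ (G P i) = P i ⬝ (G P j)
    have h1 : P j ⬝ᵥ (G *ᵥ P i) = (P j ᵥ* G) ⬝ᵥ P i := Matrix.dotProduct_mulVec _ _ _
    have h2 : P j ᵥ* G = G *ᵥ P j := by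
      have hGt : Gᵀ = G := hG
      calc P j ᵥ* G = P j ᵥ* Gᵀ := by rw [hGt]
        _ = G *ᵥ P j := Matrix.vecMul_transpose G (P j)
    rw [h1, h2, dotProduct_comm]
  have hK : K.IsHermitian := isHermitian_of_isSymm hKsymm
  -- the combination map
  let Φ : (Fin k → ℝ) → (ι → ℝ) := fun y => ∑ i, y i • P i
  have hΦker : ∀ y, A *ᵥ Φ y = 0 := by
    intro y
    simp only [Φ, Matrix.mulVec_sum, Matrix.mulVec_smul, hker, smul_zero, Finset.sum_const_zero]
  have hΦform : ∀ y, Φ y ⬝ᵥ (G *ᵥ Φ y) = y ⬝ᵥ (K *ᵥ y) := fun y => form_comb_eq G P y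
  have hΦinj : ∀ y, Φ y = 0 → y = 0 := by
    intro y hy
    funext i
    exact Fintype.linearIndependent_iff.1 hli y hy i
  -- eigenvector families of K
  let b : Fin k → Fin k → ℝ := fun l => (hK.eigenvectorBasis l).ofLp
  let βp := {l // 0 < hK.eigenvalues l}
  let γp := {l // hK.eigenvalues l ≤ 0}
  have hΦcomb : ∀ {α : Type} [Fintype α] (f : α → Fin k) (c : α → ℝ),
      ∑ j, c j • Φ (b (f j)) = Φ (∑ j, c j • b (f j)) := by
    intro α _ f c
    simp only [Φ]
    rw [sum_sum_smul_comm P (fun j => b (f j)) c]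
  -- transport to Fin-indexed families
  let ep : Fin (Fintype.card βp) ≃ βp := (Fintype.equivFin βp).symm
  let eq : Fin (Fintype.card γp) ≃ γp := (Fintype.equivFin γp).symm
  refine ⟨Fintype.card βp, Fintype.card γp, fun j => Φ (b (ep j).1), fun j => Φ (b (eq j).1),
    fun j => hΦker _, fun j => hΦker _, ?_, ?_, ?_, ?_⟩
  · -- positivity on combinations of the positive family
    intro c hc
    rw [hΦcomb (fun j => (ep j).1) c, hΦform]
    -- re-index the combination over βp
    have hre : ∑ j, c j • b (ep j).1 = ∑ i : βp, (c (ep.symm i)) • b i.1 := by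
      exact Fintype.sum_equiv ep _ _ (fun j => by simp)
    rw [hre]
    have hc' : (fun i : βp => c (ep.symm i)) ≠ 0 := by
      intro h0
      apply hc
      funext j
      have := congrFun h0 (ep j)
      simpa using this
    exact pos_eigenFamily hK _ hc'
  · -- non-positivity on combinations of the non-positive family
    intro c
    rw [hΦcomb (fun j => (eq j).1) c, hΦform]
    have hre : ∑ j, c j • b (eq j).1 = ∑ i : γp, (c (eq.symm i)) • b i.1 := by
      exact Fintype.sum_equiv eq _ _ (fun j => by simp)
    rw [hre]
    exact nonpos_eigenFamily hK _
  · -- linear independence of the non-positive family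
    rw [Fintype.linearIndependent_iff]
    intro c hc j
    rw [hΦcomb (fun j => (eq j).1) c] at hc
    have h0 := hΦinj _ hc
    have hre : ∑ j, c j • b (eq j).1 = ∑ i : γp, (c (eq.symm i)) • b i.1 := by
      exact Fintype.sum_equiv eq _ _ (fun j => by simp)
    rw [hre] at h0
    have hind := linearIndependent_subtype_eigen hK (fun l => hK.eigenvalues l ≤ 0)
    have := Fintype.linearIndependent_iff.1 hind (fun i => c (eq.symm i)) h0 (eq j)
    simpa using this
  · -- the count
    have h := card_nonpos_eigs hK
    have hle := Fintype.card_subtype_le fun l => 0 < hK.eigenvalues l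
    simp only [Fintype.card_fin] at h hle
    have hcount : Fintype.card {l // 0 < hK.eigenvalues l} + Fintype.card {l // hK.eigenvalues l ≤ 0} = k := by omega
    have hcount' : Fintype.card βp + Fintype.card γp = k := hcount
    omega

end Inertia

end Summit.ValiantsHypothesis.ValiantsHypothesis.Theorems.LacunarySymmetroidMatrixDescartes
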